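import Summits.AtomisticToContinuum.Crystallization.Theorems.ChargedEnergyGapBlockFubini
import HarnessLib

/-!
# Charged energy gap — lens-3 g65, node «BarlowRef» (R3) — part 23 «ChargingFrame»: the PERIODIC CHARGING FRAME of P-Z₅d (item 1, abstract half)

Cell `decomp-a2c`, seat lens-3, generation 65.  Imports only the tree (`…BlockFubini`, part 7).  ELEMENTARY·PROVED, geometry-free: finite double
counting plus the periodic refolding of P-W, written for EQUIVARIANT BLOCK ASSIGNMENTS.  This is the combinatorial frame through which the per-member
share bounds `TubeShareBoundH` (part 6, the prover target of record) are consumed by the residual `BulkFarResidueBoundB` (parts 24–25 instantiate it).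

SETTING.  `P` a periodic configuration (points `F + Λ`); a `Λ`-invariant pair weight `w ≥ 0` (the bulk-pair tension); `Λ`-periodic carrier BUDGETS
`β ≥ 0` and load RATES `Λr` (positive on the motif); an `Λ`-EQUIVARIANT block assignment `Blk (y + g) (z + g) = Blk y z + g` with `Blk y z ⊆ points`
for every live pair (`0 < w y z`); the HARMONIC CRITERION `1 ≤ Σ_{c ∈ Blk y z} β c / Λr c` per live pair (part 9's criterion with `M = 1`); and the
LOAD HYPOTHESIS per MOTIF carrier `c₀`: `Σ_{p ∈ Q} w p ≤ Λr c₀` for every finite set `Q` of live pairs of points whose blocks contain `c₀` (the shape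
`TubeShareBoundH` delivers: arbitrary finite sources / targets `F, G ⊆ P.points`).
* `motifRep` — the motif representative of a point (`c − motifRep c ∈ Λ`), `motifRep_eq_iff`, `motifRep_add`;
* ★★ `motif_pair_sum_le_budget` — under the setting: `Σ_{y ∈ motif} Σ_{z ∈ G} w y z ≤ Σ_{c ∈ motif} β c` for every finite `G ⊆ P.points`.
PROOF.  Shares of a pair over the motif CLASSES of its block (`σ p c₀ = Σ_{c ∈ Blk p, c ≡ c₀} (β c/Λr c) / H p`, `H p = Σ_{Blk p} β/Λr ≥ 1`) feed
part 7's `sum_le_sum_budget_of_shares` with carriers = the motif; the class load of `c₀` is REFOLDED: `(p, c) ↦ p − (c − c₀)` is injective on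
`{(p, c) : p live motif-pair, c ∈ Blk p, c ≡ c₀}` (motif sites are inequivalent mod `Λ`), lands in live pairs of points whose block contains `c₀`
(equivariance) and preserves `w` (invariance) — so it is bounded by the load hypothesis at `c₀`.  This is why a MOTIF carrier must absorb the pairs
of ALL translates, i.e. why `TubeShareBoundH` quantifies arbitrary finite `F, G`.

0 sorry; standard axioms.
-/

noncomputable section

open scoped Classical

open Literature.MathematicalPhysics.StatisticalMechanics Literature.Geometry.DiscreteGeometry
open Summit.AtomisticToContinuum.Crystallization.Theses.PricedLinkCensus
open Summit.AtomisticToContinuum.Crystallization.Theorems.ChargedEnergyGapNegative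

namespace Summit.AtomisticToContinuum.Crystallization.Theorems.ChargedEnergyGapChartDial

section ChargingFrame

variable (P : PeriodicConfiguration 3)

/-- The MOTIF REPRESENTATIVE of a point of `P` (junk value `c` itself off `P.points`). -/
def motifRep (c : E3) : E3 :=
  if h : c ∈ P.points then h.choose else c

/-- The representative lies in the motif and differs from the point by a lattice vector. -/
theorem motifRep_spec {c : E3} (hc : c ∈ P.points) : motifRep P c ∈ P.motif ∧ c - motifRep P c ∈ P.lattice := by
  unfold motifRep
  rw [dif_pos hc]
  obtain ⟨hm, g, hg, hcg⟩ := hc.choose_spec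
  exact ⟨hm, (sub_eq_iff_eq_add'.2 hcg) ▸ hg⟩

/-- `motifRep c ∈ motif`. [formal bookkeeping] -/
theorem motifRep_mem {c : E3} (hc : c ∈ P.points) : motifRep P c ∈ P.motif :=
  (motifRep_spec P hc).1

/-- `c − motifRep c ∈ Λ`. [formal bookkeeping] -/
theorem sub_motifRep_mem {c : E3} (hc : c ∈ P.points) : c - motifRep P c ∈ P.lattice :=
  (motifRep_spec P hc).2

/-- ★ The representative is CHARACTERISED by `c − c₀ ∈ Λ` (motif sites are pairwise inequivalent modulo `Λ`). -/
theorem motifRep_eq_iff {c c₀ : E3} (hc : c ∈ P.points) (hc₀ : c₀ ∈ P.motif) : motifRep P c = c₀ ↔ c - c₀ ∈ P.lattice := by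
  constructor
  · rintro rfl
    exact sub_motifRep_mem P hc
  · intro h
    refine P.eq_of_sub_mem _ (motifRep_mem P hc) _ hc₀ ?_
    have : motifRep P c - c₀ = (c - c₀) - (c - motifRep P c) := by abel
    rw [this]
    exact P.lattice.sub_mem h (sub_motifRep_mem P hc)

/-- The representative is `Λ`-periodic. -/
theorem motifRep_add {c g : E3} (hc : c ∈ P.points) (hg : g ∈ P.lattice) : motifRep P (c + g) = motifRep P c := by
  rw [motifRep_eq_iff P (P.add_mem_points hc hg) (motifRep_mem P hc)]
  have : c + g - motifRep P c = (c - motifRep P c) + g := by abel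
  rw [this]
  exact P.lattice.add_mem (sub_motifRep_mem P hc) hg

/-- Subtracting a lattice vector keeps a point in `P.points`. [formal bookkeeping] -/
theorem sub_mem_points {z g : E3} (hz : z ∈ P.points) (hg : g ∈ P.lattice) : z - g ∈ P.points := by
  rw [sub_eq_add_neg z g]
  exact P.add_mem_points hz (P.lattice.neg_mem hg)

/-- ★★ **THE PERIODIC CHARGING FRAME.**  `Λ`-invariant pair weight `w ≥ 0`, `Λ`-periodic budgets `β ≥ 0` and rates `Λr` (positive on the motif),
`Λ`-equivariant blocks inside `P.points` satisfying the harmonic criterion `1 ≤ Σ_{c ∈ Blk y z} β c / Λr c` on live pairs, and the per-motif-carrier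
load hypothesis `Σ_{p ∈ Q} w p ≤ Λr c₀` for every finite set `Q` of live pairs of points whose blocks contain `c₀`
⟹ `Σ_{y ∈ motif} Σ_{z ∈ G} w y z ≤ Σ_{c ∈ motif} β c` for every finite `G ⊆ P.points`. -/
theorem motif_pair_sum_le_budget (w : E3 → E3 → ℝ) (β Λr : E3 → ℝ) (Blk : E3 → E3 → Finset E3)
    (hw0 : ∀ y z, 0 ≤ w y z) (hw : ∀ g ∈ P.lattice, ∀ y z, w (y + g) (z + g) = w y z)
    (hβ0 : ∀ c, 0 ≤ β c) (hβ : ∀ g ∈ P.lattice, ∀ c ∈ P.points, β (c + g) = β c)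
    (hΛ : ∀ g ∈ P.lattice, ∀ c ∈ P.points, Λr (c + g) = Λr c) (hΛ0 : ∀ c ∈ P.motif, 0 < Λr c)
    (hBlk : ∀ g ∈ P.lattice, ∀ y ∈ P.points, ∀ z ∈ P.points, 0 < w y z → Blk (y + g) (z + g) = (Blk y z).image (· + g))
    (hsub : ∀ y ∈ P.points, ∀ z ∈ P.points, 0 < w y z → (↑(Blk y z) : Set E3) ⊆ P.points)
    (hharm : ∀ y ∈ P.points, ∀ z ∈ P.points, 0 < w y z → 1 ≤ ∑ c ∈ Blk y z, β c / Λr c)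
    (hload : ∀ c₀ ∈ P.motif, ∀ Q : Finset (E3 × E3),
      (∀ p ∈ Q, p.1 ∈ P.points ∧ p.2 ∈ P.points ∧ 0 < w p.1 p.2 ∧ c₀ ∈ Blk p.1 p.2) → ∑ p ∈ Q, w p.1 p.2 ≤ Λr c₀)
    (G : Finset E3) (hG : (↑G : Set E3) ⊆ P.points) :
    ∑ y ∈ P.motif, ∑ z ∈ G, w y z ≤ ∑ c ∈ P.motif, β c := by
  -- the LIVE pairs
  set Pairs : Finset (E3 × E3) := (P.motif ×ˢ G).filter (fun p => 0 < w p.1 p.2) with hPairs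
  have hmem : ∀ p ∈ Pairs, p.1 ∈ P.points ∧ p.2 ∈ P.points ∧ 0 < w p.1 p.2 := by
    intro p hp
    rw [hPairs, Finset.mem_filter, Finset.mem_product] at hp
    exact ⟨P.mem_points_of_mem_motif hp.1.1, hG hp.1.2, hp.2⟩
  have hmotif : ∀ p ∈ Pairs, p.1 ∈ P.motif := by
    intro p hp
    rw [hPairs, Finset.mem_filter, Finset.mem_product] at hp
    exact hp.1.1
  have hLHS : ∑ y ∈ P.motif, ∑ z ∈ G, w y z = ∑ p ∈ Pairs, w p.1 p.2 := by
    rw [← Finset.sum_product (s := P.motif) (t := G) (f := fun p : E3 × E3 => w p.1 p.2), hPairs, Finset.sum_filter]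
    refine Finset.sum_congr rfl fun p _ => ?_
    split_ifs with h
    · rfl
    · exact le_antisymm (not_lt.1 h) (hw0 _ _)
  rw [hLHS]
  -- block members in the motif class of `c₀`
  set Fib : E3 × E3 → E3 → Finset E3 := fun p c₀ => (Blk p.1 p.2).filter (fun c => motifRep P c = c₀) with hFib
  have hFibP : ∀ p ∈ Pairs, ∀ c₀ ∈ P.motif, ∀ c ∈ Fib p c₀, c ∈ Blk p.1 p.2 ∧ c ∈ P.points ∧ c - c₀ ∈ P.lattice := by
    intro p hp c₀ hc₀ c hc
    rw [hFib, Finset.mem_filter] at hc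
    have hcP : c ∈ P.points := hsub _ (hmem p hp).1 _ (hmem p hp).2.1 (hmem p hp).2.2 hc.1
    exact ⟨hc.1, hcP, (motifRep_eq_iff P hcP hc₀).1 hc.2⟩
  -- the harmonic normaliser
  set H : E3 × E3 → ℝ := fun p => ∑ c ∈ Blk p.1 p.2, β c / Λr c with hH
  have hH1 : ∀ p ∈ Pairs, 1 ≤ H p := fun p hp => hharm _ (hmem p hp).1 _ (hmem p hp).2.1 (hmem p hp).2.2
  refine sum_le_sum_budget_of_shares Pairs P.motif (fun p => w p.1 p.2) (fun p c₀ => (∑ c ∈ Fib p c₀, β c / Λr c) / H p) β ?_ ?_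
  · -- the class shares of a live pair sum to one
    intro p hp
    have hHp : 0 < H p := lt_of_lt_of_le one_pos (hH1 p hp)
    have hmaps : ∀ c ∈ Blk p.1 p.2, motifRep P c ∈ P.motif :=
      fun c hc => motifRep_mem P (hsub _ (hmem p hp).1 _ (hmem p hp).2.1 (hmem p hp).2.2 hc)
    show ∑ c₀ ∈ P.motif, (∑ c ∈ Fib p c₀, β c / Λr c) / H p = 1
    rw [← Finset.sum_div, hFib, Finset.sum_fiberwise_of_maps_to hmaps, div_self hHp.ne']
  · -- the class load of a motif carrier `c₀`
    intro c₀ hc₀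
    have hΛc : 0 < Λr c₀ := hΛ0 c₀ hc₀
    -- periodicity: inside the class of `c₀`, `β c / Λr c = β c₀ / Λr c₀`
    have hcls : ∀ p ∈ Pairs, ∀ c ∈ Fib p c₀, β c / Λr c = β c₀ / Λr c₀ := by
      intro p hp c hc
      obtain ⟨-, -, hg⟩ := hFibP p hp c₀ hc₀ c hc
      have h1 : β c = β c₀ := by
        have := hβ _ hg c₀ (P.mem_points_of_mem_motif hc₀)
        rwa [add_sub_cancel] at this
      have h2 : Λr c = Λr c₀ := by
        have := hΛ _ hg c₀ (P.mem_points_of_mem_motif hc₀)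
        rwa [add_sub_cancel] at this
      rw [h1, h2]
    -- share · weight ≤ (β c₀/Λr c₀) · (#class) · weight
    have hS : ∀ p ∈ Pairs, (∑ c ∈ Fib p c₀, β c / Λr c) / H p * w p.1 p.2 ≤ β c₀ / Λr c₀ * ∑ _c ∈ Fib p c₀, w p.1 p.2 := by
      intro p hp
      have hsum : ∑ c ∈ Fib p c₀, β c / Λr c = ((Fib p c₀).card : ℝ) * (β c₀ / Λr c₀) := by
        rw [Finset.sum_congr rfl (hcls p hp), Finset.sum_const, nsmul_eq_mul]
      have hnn : 0 ≤ ((Fib p c₀).card : ℝ) * (β c₀ / Λr c₀) := by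
        have := hβ0 c₀
        positivity
      rw [hsum, Finset.sum_const, nsmul_eq_mul]
      calc ((Fib p c₀).card : ℝ) * (β c₀ / Λr c₀) / H p * w p.1 p.2
          ≤ ((Fib p c₀).card : ℝ) * (β c₀ / Λr c₀) * w p.1 p.2 :=
            mul_le_mul_of_nonneg_right (div_le_self hnn (hH1 p hp)) (hw0 _ _)
        _ = β c₀ / Λr c₀ * (((Fib p c₀).card : ℝ) * w p.1 p.2) := by ring
    -- REFOLDING of the class load
    have hrefold : ∑ p ∈ Pairs, ∑ _c ∈ Fib p c₀, w p.1 p.2 ≤ Λr c₀ := by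
      set T : Finset ((E3 × E3) × E3) := (Pairs ×ˢ Pairs.biUnion (fun p => Fib p c₀)).filter (fun x => x.2 ∈ Fib x.1 c₀) with hT
      have hTmem : ∀ x : (E3 × E3) × E3, x ∈ T ↔ x.1 ∈ Pairs ∧ x.2 ∈ Fib x.1 c₀ := by
        intro x
        rw [hT, Finset.mem_filter, Finset.mem_product, Finset.mem_biUnion]
        constructor
        · rintro ⟨⟨h1, _⟩, h2⟩
          exact ⟨h1, h2⟩
        · rintro ⟨h1, h2⟩
          exact ⟨⟨h1, x.1, h1, h2⟩, h2⟩
      rw [← Finset.sum_finset_product T Pairs (fun p => Fib p c₀) hTmem (f := fun x => w x.1.1 x.1.2)]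
      have hTfacts : ∀ x ∈ T, x.1.1 ∈ P.motif ∧ x.1.2 ∈ P.points ∧ 0 < w x.1.1 x.1.2 ∧ x.2 ∈ Blk x.1.1 x.1.2 ∧ x.2 - c₀ ∈ P.lattice := by
        intro x hx
        obtain ⟨hp, hc⟩ := (hTmem x).1 hx
        obtain ⟨hcB, -, hg⟩ := hFibP _ hp c₀ hc₀ _ hc
        exact ⟨hmotif _ hp, (hmem _ hp).2.1, (hmem _ hp).2.2, hcB, hg⟩
      -- the refolding map and its injectivity on `T`
      let φ : (E3 × E3) × E3 → E3 × E3 := fun x => (x.1.1 - (x.2 - c₀), x.1.2 - (x.2 - c₀))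
      have hinj : ∀ x ∈ T, ∀ x' ∈ T, φ x = φ x' → x = x' := by
        intro x hx x' hx' h
        obtain ⟨hy, -, -, -, hg⟩ := hTfacts x hx
        obtain ⟨hy', -, -, -, hg'⟩ := hTfacts x' hx'
        have h1 : x.1.1 - (x.2 - c₀) = x'.1.1 - (x'.2 - c₀) := congrArg Prod.fst h
        have h2 : x.1.2 - (x.2 - c₀) = x'.1.2 - (x'.2 - c₀) := congrArg Prod.snd h
        have h1' : x.1.1 - x'.1.1 = (x.2 - c₀) - (x'.2 - c₀) := sub_eq_sub_iff_sub_eq_sub.1 h1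
        have hyy : x.1.1 = x'.1.1 := by
          refine P.eq_of_sub_mem _ hy _ hy' ?_
          rw [h1']
          exact P.lattice.sub_mem hg hg'
        have hcc : x.2 = x'.2 := by
          rw [hyy, sub_self] at h1'
          have : x.2 - c₀ = x'.2 - c₀ := (sub_eq_zero.1 h1'.symm)
          exact sub_left_injective this
        have hzz : x.1.2 = x'.1.2 := by
          rw [hcc] at h2
          exact sub_left_injective h2
        exact Prod.ext (Prod.ext hyy hzz) hcc
      have hwφ : ∀ x ∈ T, w x.1.1 x.1.2 = w (φ x).1 (φ x).2 := by
        intro x hx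
        obtain ⟨-, -, -, -, hg⟩ := hTfacts x hx
        have := hw (-(x.2 - c₀)) (P.lattice.neg_mem hg) x.1.1 x.1.2
        show w x.1.1 x.1.2 = w (x.1.1 - (x.2 - c₀)) (x.1.2 - (x.2 - c₀))
        rw [sub_eq_add_neg x.1.1, sub_eq_add_neg x.1.2]
        exact this.symm
      have himg : ∑ p ∈ T.image φ, w p.1 p.2 = ∑ x ∈ T, w (φ x).1 (φ x).2 := Finset.sum_image hinj
      rw [Finset.sum_congr rfl hwφ, ← himg]
      refine hload c₀ hc₀ (T.image φ) fun p' hp' => ?_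
      rw [Finset.mem_image] at hp'
      obtain ⟨x, hx, rfl⟩ := hp'
      obtain ⟨hy, hz, hwp, hc, hg⟩ := hTfacts x hx
      have hy' : x.1.1 - (x.2 - c₀) ∈ P.points := sub_mem_points P (P.mem_points_of_mem_motif hy) hg
      have hz' : x.1.2 - (x.2 - c₀) ∈ P.points := sub_mem_points P hz hg
      have hw' : 0 < w (x.1.1 - (x.2 - c₀)) (x.1.2 - (x.2 - c₀)) := by
        have := hwφ x hx
        rw [this] at hwp
        exact hwp
      refine ⟨hy', hz', hw', ?_⟩
      · -- `c₀ ∈ Blk (y − g) (z − g)` by equivariance (`g = c − c₀`)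
        have key := hBlk (x.2 - c₀) hg _ hy' _ hz' hw'
        rw [sub_add_cancel, sub_add_cancel] at key
        have hc' := hc
        rw [key, Finset.mem_image] at hc'
        obtain ⟨c', hc'mem, hc'eq⟩ := hc'
        have : c' = c₀ := by
          rw [eq_sub_of_add_eq hc'eq, sub_sub_cancel]
        exact this ▸ hc'mem
    calc ∑ p ∈ Pairs, (∑ c ∈ Fib p c₀, β c / Λr c) / H p * w p.1 p.2
        ≤ ∑ p ∈ Pairs, β c₀ / Λr c₀ * ∑ _c ∈ Fib p c₀, w p.1 p.2 := Finset.sum_le_sum hS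
      _ = β c₀ / Λr c₀ * ∑ p ∈ Pairs, ∑ _c ∈ Fib p c₀, w p.1 p.2 := by rw [Finset.mul_sum]
      _ ≤ β c₀ / Λr c₀ * Λr c₀ := mul_le_mul_of_nonneg_left hrefold (div_nonneg (hβ0 _) hΛc.le)
      _ = β c₀ := div_mul_cancel₀ _ hΛc.ne'

end ChargingFrame

end Summit.AtomisticToContinuum.Crystallization.Theorems.ChargedEnergyGapChartDial
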